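import Summits.ValiantsHypothesis.ValiantsHypothesis.Theses.LangWeilTransfer
import Summits.ValiantsHypothesis.ValiantsHypothesis.Theorems.LangWeilTransferGoodReductionAbsIrreducible
import Summits.ValiantsHypothesis.ValiantsHypothesis.Theorems.LangWeilTransferAssemblyPrelims
import Literature.NumberTheory.Sieve.BombieriAsymptoticSieveSigma0Comb

/-!
# LangWeilTransfer, support item `GoodReduction` (stmt-ValiantsHypothesis-6377) — the univariate
# slice (`m = 0`), PROVED (partial range)

Route `LangWeilTransfer` of `ValiantsHypothesis`, support item `GoodReduction` (effective
Noether–Ostrowski over the geometric factors). The landed slice `goodReduction_of_isAbsIrreducible`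
covers absolutely irreducible `Q` (one geometric factor). This file proves the item's conclusion
VERBATIM for `m = 0`, i.e. for UNIVARIATE `Q ∈ ℤ[x₀]` irreducible over `ℚ` of any degree — the
range Kaltofen's Theorem 8 (the engine of the general case, `n ≥ 2` variables) does not cover:

* `natDegree_le_ncard_minimalPrimes` — the number `g` of geometric components of `(Q)` in
  `ℚ̄[x₀]`, as the item phrases it (`ncard` of the minimal primes of the extended ideal), is at least
  the degree `D` of `Q`: the `D` distinct roots `α` of `Q` in `ℚ̄` (irreducible over `ℚ` ⇒
  separable) give `D` distinct minimal primes `(x₀ - α)` — minimal because `Q` splits into linear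
  factors, so a prime between `(Q)` and `(x₀ - α)` contains some `x₀ - β`, forcing `β = α`;
* `exists_root_galoisField` — an irreducible `h ∈ 𝔽_p[X]` of degree `f'` has a root in
  `GaloisField p f'` (`FiniteField.nonempty_algHom_of_finrank_dvd` on `AdjoinRoot h`);
* `goodReduction_univariate` — for `p` not dividing the leading coefficient (`≤ log₂ wt Q` primes,
  `BombieriSieve.card_primeFactors_le_log`), an irreducible factor `h` of `Q mod p` has degree
  `f' ≤ D ≤ g ≤ f`, a root `β ∈ GaloisField p f'`, and `Q₁ = x₀ - β` is an absolutely irreducible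
  (`isAbsIrreducible_of_linear`) divisor of `Q mod p` over `GaloisField p f'`. Constant `a = 1`.

What remains OPEN of the item: `m ≥ 1` with `≥ 2` geometric components (Galois descent + a
height-controlled Kronecker model feeding the tree theorem `kaltofen1995_thm8_holds`; plan note on
the item). Honest framing: bookkeeping inside a dormant conditional route; `VP ≠ VNP` is NOT proved.
-/

noncomputable section

open MvPolynomial

-- the summit and the problem share the name `ValiantsHypothesis` (D-0017 single-conjunct layout)
set_option linter.dupNamespace false

namespace Summit.ValiantsHypothesis.ValiantsHypothesis.Theorems.LangWeilTransfer

open Literature.NumberTheory.DiophantineGeometry (IsAbsIrreducible)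
open Literature.Computability.AlgebraicComplexity (weight)

/-! ### One variable: linear factors and minimal primes -/

section OneVar

variable {L : Type*} [Field L]

/-- `uniqueAlgEquiv` sends `x₀ - α` to `X - α`. -/
theorem uniqueAlgEquiv_X_sub_C (α : L) :
    uniqueAlgEquiv L (Fin 1) (X 0 - C α : MvPolynomial (Fin 1) L) = Polynomial.X - Polynomial.C α := by
  simp [uniqueAlgEquiv_apply]

/-- `x₀ - α ∣ F` iff `F(α) = 0` (one variable). -/
theorem X_sub_C_dvd_iff (α : L) (F : MvPolynomial (Fin 1) L) :
    (X 0 - C α : MvPolynomial (Fin 1) L) ∣ F ↔ MvPolynomial.eval (fun _ => α) F = 0 := by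
  set e := uniqueAlgEquiv L (Fin 1) with he
  constructor
  · intro h
    have h2 := map_dvd e h
    rw [uniqueAlgEquiv_X_sub_C, Polynomial.dvd_iff_isRoot, Polynomial.IsRoot.def,
      eval_uniqueAlgEquiv] at h2
    exact h2
  · intro h
    have h2 : (Polynomial.X - Polynomial.C α) ∣ e F := by
      rw [Polynomial.dvd_iff_isRoot, Polynomial.IsRoot.def, eval_uniqueAlgEquiv]; exact h
    have h3 := map_dvd e.symm h2
    rwa [← uniqueAlgEquiv_X_sub_C, AlgEquiv.symm_apply_apply, AlgEquiv.symm_apply_apply] at h3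

/-- `(x₀ - α)` is a prime ideal of `L[x₀]`. -/
theorem isPrime_span_X_sub_C (α : L) :
    (Ideal.span {(X 0 - C α : MvPolynomial (Fin 1) L)}).IsPrime := by
  have hirr : Irreducible (X 0 - C α : MvPolynomial (Fin 1) L) := by
    have h := Polynomial.irreducible_X_sub_C α
    rw [← uniqueAlgEquiv_X_sub_C] at h
    exact (MulEquiv.irreducible_iff (uniqueAlgEquiv L (Fin 1))).mp h
  exact (Ideal.span_singleton_prime hirr.ne_zero).mpr hirr.prime

/-- Over an algebraically closed field, for every root `α` of `F ≠ 0` the ideal `(x₀ - α)` is a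
minimal prime over `(F)`: a prime between them contains one of the linear factors `x₀ - β` of `F`,
and `x₀ - β ∈ (x₀ - α)` forces `β = α`. -/
theorem span_X_sub_C_mem_minimalPrimes [IsAlgClosed L] {F : MvPolynomial (Fin 1) L} (hF : F ≠ 0)
    {α : L} (hα : MvPolynomial.eval (fun _ => α) F = 0) :
    Ideal.span {(X 0 - C α : MvPolynomial (Fin 1) L)} ∈ (Ideal.span {F}).minimalPrimes := by
  set e := uniqueAlgEquiv L (Fin 1) with he
  refine ⟨⟨isPrime_span_X_sub_C α,
    (Ideal.span_singleton_le_span_singleton).mpr ((X_sub_C_dvd_iff α F).mpr hα)⟩, ?_⟩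
  rintro q ⟨hq, hFq⟩ hqle
  -- `F = c · ∏ (x₀ - β)` over the roots `β`
  have hsplit := (IsAlgClosed.splits (e F)).eq_prod_roots
  have hFq' : F ∈ q := hFq (Ideal.mem_span_singleton_self F)
  have heF : F = e.symm (Polynomial.C (e F).leadingCoeff) *
      ((e F).roots.map fun β => (X 0 - C β : MvPolynomial (Fin 1) L)).prod := by
    conv_lhs => rw [← e.symm_apply_apply F, hsplit]
    rw [map_mul, map_multiset_prod, Multiset.map_map]
    congr 2
    refine Multiset.map_congr rfl fun β _ => ?_
    rw [Function.comp_apply, ← uniqueAlgEquiv_X_sub_C, AlgEquiv.symm_apply_apply]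
  rw [heF] at hFq'
  have hc : e.symm (Polynomial.C (e F).leadingCoeff) ∉ q := by
    intro hmem
    have hne : (e F).leadingCoeff ≠ 0 := by
      rw [Ne, Polynomial.leadingCoeff_eq_zero, EmbeddingLike.map_eq_zero_iff]; exact hF
    have hunit : IsUnit (e.symm (Polynomial.C (e F).leadingCoeff)) := by
      rw [show e.symm (Polynomial.C (e F).leadingCoeff) = C (e F).leadingCoeff by simp [he]]
      exact hne.isUnit.map C
    exact hq.ne_top (Ideal.eq_top_of_isUnit_mem _ hmem hunit)
  rcases hq.mem_or_mem hFq' with h | h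
  · exact absurd h hc
  · obtain ⟨g, hg, hgq⟩ := (hq.multiset_prod_mem_iff_exists_mem _).mp h
    obtain ⟨β, _, rfl⟩ := Multiset.mem_map.mp hg
    -- `x₀ - β ∈ q ⊆ (x₀ - α)` forces `β = α`
    have hdvd : (X 0 - C α : MvPolynomial (Fin 1) L) ∣ X 0 - C β :=
      Ideal.mem_span_singleton.mp (hqle hgq)
    have hβ : β = α := by
      have := (X_sub_C_dvd_iff α _).mp hdvd
      simp only [map_sub, eval_X, eval_C, sub_eq_zero] at this
      exact this.symm
    subst hβ
    exact (Ideal.span_singleton_le_iff_mem _).mpr hgq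

/-- **Geometric components of a univariate polynomial**: for `Q ∈ ℤ[x₀]` irreducible over `ℚ`, the
degree of `Q` is at most the number of minimal primes of `(Q)` in `ℚ̄[x₀]`, as the item counts
them (in fact equal). -/
theorem natDegree_le_ncard_minimalPrimes (Q : MvPolynomial (Fin (0 + 1)) ℤ)
    (hirr : Irreducible (MvPolynomial.map (Int.castRingHom ℚ) Q))
    (hpos : 0 < ((Ideal.map (MvPolynomial.map (algebraMap ℚ (AlgebraicClosure ℚ)))
      (Ideal.span {MvPolynomial.map (Int.castRingHom ℚ) Q})).minimalPrimes).ncard) :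
    (uniqueAlgEquiv ℚ (Fin 1) (MvPolynomial.map (Int.castRingHom ℚ) Q)).natDegree ≤
      ((Ideal.map (MvPolynomial.map (algebraMap ℚ (AlgebraicClosure ℚ)))
        (Ideal.span {MvPolynomial.map (Int.castRingHom ℚ) Q})).minimalPrimes).ncard := by
  classical
  set L := AlgebraicClosure ℚ with hL
  set Qℚ : MvPolynomial (Fin 1) ℚ := MvPolynomial.map (Int.castRingHom ℚ) Q with hQℚ
  set QL : MvPolynomial (Fin 1) L := MvPolynomial.map (algebraMap ℚ L) Qℚ with hQL
  set I : Ideal (MvPolynomial (Fin 1) L) :=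
    Ideal.map (MvPolynomial.map (algebraMap ℚ L)) (Ideal.span {Qℚ}) with hI
  have hIspan : I = Ideal.span {QL} := by
    rw [hI, Ideal.map_span, Set.image_singleton]
  -- the univariate pictures
  set q : Polynomial ℚ := uniqueAlgEquiv ℚ (Fin 1) Qℚ with hq
  have hqirr : Irreducible q := (MulEquiv.irreducible_iff (uniqueAlgEquiv ℚ (Fin 1))).mpr hirr
  have hqL : uniqueAlgEquiv L (Fin 1) QL = q.map (algebraMap ℚ L) := by
    rw [hQL, uniqueAlgEquiv_map]
  have hQL0 : QL ≠ 0 := by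
    intro h0
    have : q.map (algebraMap ℚ L) = 0 := by rw [← hqL, h0, map_zero]
    rw [Polynomial.map_eq_zero] at this
    exact hqirr.ne_zero this
  -- distinct roots of `q` in `L`
  have hsep : (q.map (algebraMap ℚ L)).Separable := hqirr.separable.map
  have hnodup : (q.map (algebraMap ℚ L)).roots.Nodup := Polynomial.nodup_roots hsep
  have hcard : (q.map (algebraMap ℚ L)).roots.toFinset.card = q.natDegree := by
    rw [Multiset.toFinset_card_of_nodup hnodup,
      ← (IsAlgClosed.splits (q.map (algebraMap ℚ L))).natDegree_eq_card_roots,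
      Polynomial.natDegree_map]
  -- the injection `α ↦ (x₀ - α)` into the minimal primes
  have hroot : ∀ α ∈ (q.map (algebraMap ℚ L)).roots.toFinset,
      MvPolynomial.eval (fun _ => α) QL = 0 := by
    intro α hα
    rw [Multiset.mem_toFinset, Polynomial.mem_roots (Polynomial.map_ne_zero hqirr.ne_zero),
      Polynomial.IsRoot.def, ← hqL, eval_uniqueAlgEquiv] at hα
    exact hα
  have hfin : I.minimalPrimes.Finite := by
    by_contra hinf
    rw [Set.Infinite.ncard (Set.not_finite.mp hinf)] at hpos
    exact lt_irrefl 0 hpos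
  rw [← hcard, ← Set.ncard_coe_finset]
  refine Set.ncard_le_ncard_of_injOn (fun α => Ideal.span {(X 0 - C α : MvPolynomial (Fin 1) L)})
    (fun α hα => ?_) (fun α hα β hβ hαβ => ?_) hfin
  · rw [hIspan]
    exact span_X_sub_C_mem_minimalPrimes hQL0 (hroot α (Finset.mem_coe.mp hα))
  · have hαβ' : Ideal.span {(X 0 - C α : MvPolynomial (Fin 1) L)} = Ideal.span {X 0 - C β} := hαβ
    have hdvd : (X 0 - C α : MvPolynomial (Fin 1) L) ∣ X 0 - C β := by
      rw [← Ideal.mem_span_singleton, hαβ']; exact Ideal.mem_span_singleton_self _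
    have := (X_sub_C_dvd_iff α _).mp hdvd
    simp only [map_sub, eval_X, eval_C, sub_eq_zero] at this
    exact this

end OneVar

/-! ### Roots of irreducible polynomials in `GaloisField` -/

/-- An irreducible `h ∈ 𝔽_p[X]` of degree `f'` has a root in `GaloisField p f'`
(`AdjoinRoot h` has `𝔽_p`-dimension `f'`, so it maps into `GaloisField p f'`). -/
theorem exists_root_galoisField {p : ℕ} [Fact p.Prime] {h : Polynomial (ZMod p)}
    (hirr : Irreducible h) :
    ∃ β : GaloisField p h.natDegree, Polynomial.aeval β h = 0 := by
  haveI : Fact (Irreducible h) := ⟨hirr⟩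
  have hne : h ≠ 0 := hirr.ne_zero
  have hdeg : h.natDegree ≠ 0 :=
    (Polynomial.natDegree_pos_iff_degree_pos.mpr (Polynomial.degree_pos_of_irreducible hirr)).ne'
  have hfin : Module.finrank (ZMod p) (AdjoinRoot h) = h.natDegree := by
    rw [(AdjoinRoot.powerBasis hne).finrank, AdjoinRoot.powerBasis_dim]
  have hdvd : Module.finrank (ZMod p) (AdjoinRoot h) ∣
      Module.finrank (ZMod p) (GaloisField p h.natDegree) := by
    rw [hfin, GaloisField.finrank p hdeg]
  obtain ⟨φ⟩ := FiniteField.nonempty_algHom_of_finrank_dvd hdvd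
  refine ⟨φ (AdjoinRoot.root h), ?_⟩
  rw [Polynomial.aeval_algHom_apply, AdjoinRoot.aeval_eq, AdjoinRoot.mk_self, map_zero]

/-! ### The univariate slice of `GoodReduction` -/

/-- **`GoodReduction` for univariate `Q` (the item at `m = 0`, conclusion verbatim, `a = 1`).**
For `Q ∈ ℤ[x₀]` irreducible over `ℚ` with `g` geometric components (`0 < g ≤ f`): outside the
`≤ log₂ wt Q` primes dividing the leading coefficient, `Q mod p` has an irreducible factor `h` of
degree `f' ≤ deg Q ≤ g ≤ f`, hence the absolutely irreducible linear divisor `x₀ - β` over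
`GaloisField p f'`, `β` a root of `h`. -/
theorem goodReduction_univariate :
    ∃ a : ℕ, ∀ (f : ℕ) (Q : MvPolynomial (Fin (0 + 1)) ℤ),
      Irreducible (MvPolynomial.map (Int.castRingHom ℚ) Q) →
      0 < ((Ideal.map (MvPolynomial.map (algebraMap ℚ (AlgebraicClosure ℚ)))
        (Ideal.span {MvPolynomial.map (Int.castRingHom ℚ) Q})).minimalPrimes).ncard →
      ((Ideal.map (MvPolynomial.map (algebraMap ℚ (AlgebraicClosure ℚ)))
        (Ideal.span {MvPolynomial.map (Int.castRingHom ℚ) Q})).minimalPrimes).ncard ≤ f →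
      ∃ bad : Finset ℕ, bad.card ≤ a * ((f + 1) * (0 + 1) * (Q.totalDegree + 1) *
          (Nat.log 2 (weight Q) + 1)) ^ a ∧
        ∀ (p : ℕ) [Fact p.Prime], p ∉ bad → ∃ f' : ℕ, 0 < f' ∧ f' ≤ f ∧
          ∃ Q₁ : MvPolynomial (Fin (0 + 1)) (GaloisField p f'),
            Irreducible (MvPolynomial.map (algebraMap (GaloisField p f')
              (AlgebraicClosure (GaloisField p f'))) Q₁) ∧
            Q₁ ∣ MvPolynomial.map (algebraMap ℤ (GaloisField p f')) Q := by
  refine ⟨1, fun f Q hirr hpos hle => ?_⟩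
  -- the integer univariate picture and its leading coefficient
  set qZ : Polynomial ℤ := uniqueAlgEquiv ℤ (Fin 1) Q with hqZ
  set q : Polynomial ℚ := uniqueAlgEquiv ℚ (Fin 1) (MvPolynomial.map (Int.castRingHom ℚ) Q) with hq
  have hqmap : q = qZ.map (Int.castRingHom ℚ) := by rw [hq, hqZ, uniqueAlgEquiv_map]
  have hqirr : Irreducible q := (MulEquiv.irreducible_iff (uniqueAlgEquiv ℚ (Fin 1))).mpr hirr
  have hDpos : 0 < q.natDegree := Polynomial.natDegree_pos_iff_degree_pos.mpr
    (Polynomial.degree_pos_of_irreducible hqirr)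
  have hDZ : qZ.natDegree = q.natDegree := by
    rw [hqmap, Polynomial.natDegree_map_eq_of_injective (Int.castRingHom ℚ).injective_int]
  have hlc : qZ.leadingCoeff ≠ 0 := by
    rw [Ne, Polynomial.leadingCoeff_eq_zero]
    intro h0
    rw [hqmap, h0, Polynomial.map_zero] at hqirr
    exact hqirr.ne_zero rfl
  -- `D ≤ g ≤ f`
  have hDg := natDegree_le_ncard_minimalPrimes Q hirr hpos
  rw [← hq] at hDg
  have hDf : q.natDegree ≤ f := hDg.trans hle
  -- bad primes: the prime divisors of the leading coefficient
  refine ⟨qZ.leadingCoeff.natAbs.primeFactors, ?_, ?_⟩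
  · have h1 := Literature.NumberTheory.Sieve.BombieriSieve.card_primeFactors_le_log
      qZ.leadingCoeff.natAbs
    have h2 : qZ.leadingCoeff.natAbs ≤ weight Q := by
      have h := natAbs_coeff_le_weight (σ := Fin 1) Q (Finsupp.single default qZ.natDegree)
      have hlc' : qZ.leadingCoeff = coeff (Finsupp.single default qZ.natDegree) Q := by
        rw [Polynomial.leadingCoeff, ← coeff_uniqueAlgEquiv (σ := Fin 1) ℤ Q qZ.natDegree]
      rw [hlc']
      exact h
    have h3 := Nat.log_mono_right (b := 2) h2
    calc qZ.leadingCoeff.natAbs.primeFactors.card ≤ Nat.log 2 (weight Q) := h1.trans h3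
      _ ≤ 1 * ((f + 1) * (0 + 1) * (Q.totalDegree + 1) * (Nat.log 2 (weight Q) + 1)) ^ 1 := by
          rw [one_mul, pow_one]
          calc Nat.log 2 (weight Q) ≤ Nat.log 2 (weight Q) + 1 := Nat.le_succ _
            _ ≤ (f + 1) * (0 + 1) * (Q.totalDegree + 1) * (Nat.log 2 (weight Q) + 1) :=
                Nat.le_mul_of_pos_left _ (by positivity)
  · intro p hp hpbad
    -- `Q mod p` as a univariate polynomial of the same degree
    set qp : Polynomial (ZMod p) := qZ.map (Int.castRingHom (ZMod p)) with hqp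
    have hlcp : (Int.castRingHom (ZMod p)) qZ.leadingCoeff ≠ 0 := by
      intro h0
      rw [eq_intCast, ZMod.intCast_zmod_eq_zero_iff_dvd] at h0
      apply hpbad
      rw [Nat.mem_primeFactors]
      exact ⟨hp.out, Int.natCast_dvd_natCast.mp (by rwa [Int.natCast_natAbs, dvd_abs]),
        Int.natAbs_ne_zero.mpr hlc⟩
    have hdegp : qp.natDegree = q.natDegree := by
      rw [hqp, Polynomial.natDegree_map_of_leadingCoeff_ne_zero _ hlcp, hDZ]
    -- an irreducible factor and a root of it in `GaloisField p f'`
    obtain ⟨h, hhirr, hhdvd⟩ := Polynomial.exists_irreducible_of_natDegree_pos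
      (show 0 < qp.natDegree by rw [hdegp]; exact hDpos)
    have hqp0 : qp ≠ 0 := by
      intro h0; rw [h0, Polynomial.natDegree_zero] at hdegp; omega
    have hf'pos : 0 < h.natDegree := Polynomial.natDegree_pos_iff_degree_pos.mpr
      (Polynomial.degree_pos_of_irreducible hhirr)
    have hf'le : h.natDegree ≤ f := (Polynomial.natDegree_le_of_dvd hhdvd hqp0).trans (hdegp ▸ hDf)
    obtain ⟨β, hβ⟩ := exists_root_galoisField hhirr
    refine ⟨h.natDegree, hf'pos, hf'le, X 0 - C β, ?_, ?_⟩
    · -- linear ⇒ absolutely irreducible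
      have hdeg1 : (X 0 - C β : MvPolynomial (Fin (0 + 1)) (GaloisField p h.natDegree)).totalDegree ≤ 1 := by
        refine (totalDegree_sub _ _).trans (max_le ?_ ?_)
        · exact (totalDegree_X (R := GaloisField p h.natDegree) (0 : Fin (0 + 1))).le
        · rw [totalDegree_C]; exact Nat.zero_le _
      have h01 : (0 : Fin (0 + 1) →₀ ℕ) ≠ Finsupp.single 0 1 := by
        intro h0
        have h := Finsupp.ext_iff.1 h0 0
        rw [Finsupp.coe_zero, Pi.zero_apply, Finsupp.single_eq_same] at h
        exact zero_ne_one h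
      have hc1 : coeff (Finsupp.single 0 1) (X 0 - C β : MvPolynomial (Fin (0 + 1)) (GaloisField p h.natDegree)) ≠ 0 := by
        rw [coeff_sub, coeff_X, coeff_C, if_neg h01, sub_zero, if_pos rfl]
        exact one_ne_zero
      exact isAbsIrreducible_of_linear hdeg1 (s := Finsupp.single 0 1) (by simp) hc1
    · -- `β` is a root of `Q mod p` pushed to `GaloisField p f'`
      apply (X_sub_C_dvd_iff β _).mpr
      have hmapK : qZ.map (algebraMap ℤ (GaloisField p h.natDegree)) =
          qp.map (algebraMap (ZMod p) (GaloisField p h.natDegree)) := by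
        rw [hqp, Polynomial.map_map, RingHom.ext_int ((algebraMap (ZMod p) _).comp (Int.castRingHom (ZMod p)))
          (algebraMap ℤ (GaloisField p h.natDegree))]
      obtain ⟨r, hr⟩ := hhdvd
      have h1 : MvPolynomial.eval (fun _ => β)
            (MvPolynomial.map (algebraMap ℤ (GaloisField p h.natDegree)) Q) =
          (qp.map (algebraMap (ZMod p) (GaloisField p h.natDegree))).eval β := by
        rw [← eval_uniqueAlgEquiv, uniqueAlgEquiv_map, ← hqZ, hmapK]
      have h2 : (qp.map (algebraMap (ZMod p) (GaloisField p h.natDegree))).eval β = 0 := by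
        rw [Polynomial.eval_map_algebraMap, hr, map_mul, hβ, zero_mul]
      exact h1.trans h2

end Summit.ValiantsHypothesis.ValiantsHypothesis.Theorems.LangWeilTransfer

end
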